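import Mathlib
import HarnessLib
/-!
# SHEET-ℝ of the viscous gCLM/OSW profile MODEL: the row `c_l = 1/3` is a closed-form rational family (algebraic kernel)

HONEST FRAMING (cell ns-blowup GROUP B «PROFILE SEARCH», human rulings D-0035/D-0074; PROFILE-SPEC §5 SHEET-ℝ):
**1-D MODEL (viscous generalised Constantin–Lax–Majda / Okamoto–Sakajo–Wunsch profile equation on `ℝ`), pen-and-paper
algebra kernel-checked here; not Euler, not Navier–Stokes; «violates: none — MODEL».** Nothing in this file is a statement
about Navier–Stokes.

OBJECT. The frozen-`ε` profile sheet (`HOME/profile/z3/SHEET.md` §1.2, [cite: OkamotoSakajoWunsch2008, eq. (3)] with dissipation)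
  `G(Ω; c_ω, c_l, a, ε) := c_ω Ω + c_l ξ Ω′ + a 𝒰 Ω′ − (HΩ) Ω − ε Ω″ = 0` on `ℝ`, `Ω` odd, `𝒰′ = HΩ`, `𝒰(0) = 0`,
`H` = Hilbert transform with the convention `H sin = −cos`. Rows of SHEET-ℝ are the lines `c_l = const` (`c_ω = 1`, `ε = 1`);
only `c_l = 1/2` is the NS-type (constant-viscosity) line — a general row corresponds to the time-dependent viscosity
`ν(t) = ε (T − t)^{2 c_l − 1}`, so the row of this file (`c_l = 1/3`) is gCLM with `ν(t) ∝ (T − t)^{−1/3}`: a homotopy object.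

THE FACT (ns-blowup-profile-eng-5 g2, STATUS «EXACT ROW», found in the data of kit job j251345 and then derived): with the
double-pole profile `f(x) = x/(1+x²)²` — the shape of the exact `a = 1/2` inviscid collapse solution of
[cite: LushnikovSilantyevSiegel2021, Thm. 2] and of the `a = 1/2`, `σ = 1` pole-dynamics solution of
[cite: AmbroseLushnikovSiegelSilantyev2024, §5.2] — the dilated profile `Ω_a(ξ) = −A f(ξ/ℓ)` solves the row equation for ALL
`ξ` iff `c_l = 1/3`, `A = 8/(3a)` and `9 ε a = (1 − 2a) ℓ²`; i.e. the whole row `c_l = 1/3`, `0 < a < 1/2`, is explicit, it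
DELOCALISES (`ℓ → ∞`) exactly at `a = 1/2` = the inviscid point `α(1/2) = 1/3`, and the end relation
`81 ε a³ κ² = 64 (1 − 2a)` for `κ := −Ω′(0) = A/ℓ` is the square-root delocalisation law in closed form.
MECHANISM: `f″ = 24 · (Hf) · f` identically (`ddProfile_eq`), so Laplacian dissipation only renormalises the quadratic term.

WHAT IS KERNEL-CHECKED HERE: (i) the calculus of the profile — `f′`, `f″` (`hasDerivAt_profile`, `hasDerivAt_dProfile`) and
`𝒰_f′ = Hf`, `𝒰_f(0) = 0` (`hasDerivAt_primProfile`, `primProfile_zero`) for the STATED closed form `Hf`; (ii) the algebra: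
the row residual of the dilated ansatz factors as `−(A x/(1+x²)⁴) · P(x²)` with an explicit quadratic `P`
(`rowResidual_eq`), it vanishes identically on the family (`rowResidual_third_eq_zero`), and conversely identical vanishing
forces `c_l = 1/3`, `aA = 8/3`, `12 ε = (A/2 − 8/3) ℓ²` (`eq_third_of_rowResidual_eq_zero`); (iii) the end relation
(`endpoint_relation`), the inviscid edge `ε = 0 ⇒ a = 1/2` (`inviscid_edge`), the amplitude `max |Ω_a| = √3/(2a)` via
`f² ≤ 27/256` with equality at `x = 1/√3` (`profile_sq_le`, `profile_inv_sqrt_three`, `amplitude_third`) and `HΩ_a(0) = 4/(3a)`.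
WHAT IS CITED, NOT PROVED: that `hilbProfile` IS the Hilbert transform of `profile` on `ℝ` (a residue computation; the library has
no Hilbert-transform operator on `ℝ` — cf. `Literature/Analysis/FluidPDE/OkamotoSakajoWunsch2008/AprioriBounds.lean`), read off
[cite: AmbroseLushnikovSiegelSilantyev2024, §5.2, formulas for `u` and `ℋω` of the double pole] (and verified numerically to
`5e-16` by the cell's sinc engine, ENGINE-E5 §3); and that `H` commutes with positive dilations (folklore), which is what turns
the row equation for `Ω_a` into `rowResidual` at `ξ = ℓ x`. No `def … : Prop` hypotheses; no analysis beyond one-variable calculus.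
PLACEMENT: cell-own MODEL lemma under `Summits/NavierStokesRegularity/OSWSelfSimilar/` (pattern of `CertificateViscousSheet`);
bears on LADDER-NS N5 / zone Z3 → N1 linear core (SHEET-ℝ structure: an exact interior row; P5 at `c_l = 1/3` exact).
-/

namespace Summit.NavierStokesRegularity.OSWSelfSimilar
namespace SheetRowThirdExactFamily

/-- The double-pole test profile `f(x) = x/(1+x²)²` (odd, decaying like `x⁻³`); the exact `a = 1/2` inviscid collapse profile of
gCLM on `ℝ` is `−(16/3)·f(ξ/l)` [cite: LushnikovSilantyevSiegel2021, Thm. 2]. -/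
noncomputable def profile (x : ℝ) : ℝ := x / (1 + x ^ 2) ^ 2

/-- Closed form of the Hilbert transform of `profile` (convention `H sin = −cos`): `(Hf)(x) = (x² − 1)/(2(1+x²)²)`.
A DEFINITION here; that it equals the p.v. integral is CITED [cite: AmbroseLushnikovSiegelSilantyev2024, §5.2]. -/
noncomputable def hilbProfile (x : ℝ) : ℝ := (x ^ 2 - 1) / (2 * (1 + x ^ 2) ^ 2)

/-- `𝒰_f(x) = −x/(2(1+x²))`, the primitive of `hilbProfile` vanishing at `0` (`𝒰′ = HΩ`, `𝒰(0) = 0` of the sheet). [folklore] -/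
noncomputable def primProfile (x : ℝ) : ℝ := -x / (2 * (1 + x ^ 2))

/-- `f′(x) = (1 − 3x²)/(1+x²)³`. [folklore] -/
noncomputable def dProfile (x : ℝ) : ℝ := (1 - 3 * x ^ 2) / (1 + x ^ 2) ^ 3

/-- `f″(x) = 12x(x² − 1)/(1+x²)⁴`. [folklore] -/
noncomputable def ddProfile (x : ℝ) : ℝ := 12 * x * (x ^ 2 - 1) / (1 + x ^ 2) ^ 4

/-- `(1 + y²)′ = 2x` at `x`. [folklore] -/
theorem hasDerivAt_one_add_sq (x : ℝ) : HasDerivAt (fun y : ℝ => 1 + y ^ 2) (2 * x) x := by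
  have h := (hasDerivAt_pow 2 x).const_add 1
  refine h.congr_deriv ?_
  norm_num

/-- `f′ = dProfile`. [folklore] -/
theorem hasDerivAt_profile (x : ℝ) : HasDerivAt profile (dProfile x) x := by
  have h2 : HasDerivAt (fun y : ℝ => (1 + y ^ 2) ^ 2) (((2 : ℕ) : ℝ) * (1 + x ^ 2) ^ (2 - 1) * (2 * x)) x :=
    (hasDerivAt_one_add_sq x).pow 2
  have hne : (1 : ℝ) + x ^ 2 ≠ 0 := by positivity
  have h3 := (hasDerivAt_id' x).div h2 (pow_ne_zero 2 hne)
  show HasDerivAt (fun y : ℝ => y / (1 + y ^ 2) ^ 2) (dProfile x) x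
  refine h3.congr_deriv ?_
  unfold dProfile
  push_cast
  field_simp
  ring

/-- `f″ = ddProfile`. [folklore] -/
theorem hasDerivAt_dProfile (x : ℝ) : HasDerivAt dProfile (ddProfile x) x := by
  have h1 : HasDerivAt (fun y : ℝ => (1 + y ^ 2) ^ 3) (((3 : ℕ) : ℝ) * (1 + x ^ 2) ^ (3 - 1) * (2 * x)) x :=
    (hasDerivAt_one_add_sq x).pow 3
  have h2 : HasDerivAt (fun y : ℝ => 1 - 3 * y ^ 2) (-(3 * (2 * x))) x := by
    have h := ((hasDerivAt_pow 2 x).const_mul 3).const_sub 1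
    refine h.congr_deriv ?_
    norm_num
  have hne : (1 : ℝ) + x ^ 2 ≠ 0 := by positivity
  have h3 := h2.div h1 (pow_ne_zero 3 hne)
  show HasDerivAt (fun y : ℝ => (1 - 3 * y ^ 2) / (1 + y ^ 2) ^ 3) (ddProfile x) x
  refine h3.congr_deriv ?_
  unfold ddProfile
  push_cast
  field_simp
  ring

/-- `𝒰_f′ = Hf` (for the stated closed form of `Hf`). [folklore] -/
theorem hasDerivAt_primProfile (x : ℝ) : HasDerivAt primProfile (hilbProfile x) x := by
  have h1 : HasDerivAt (fun y : ℝ => 2 * (1 + y ^ 2)) (2 * (2 * x)) x := (hasDerivAt_one_add_sq x).const_mul 2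
  have h2 : HasDerivAt (fun y : ℝ => -y) (-1) x := (hasDerivAt_id' x).neg
  have hne : (1 : ℝ) + x ^ 2 ≠ 0 := by positivity
  have h3 := h2.div h1 (mul_ne_zero two_ne_zero hne)
  show HasDerivAt (fun y : ℝ => -y / (2 * (1 + y ^ 2))) (hilbProfile x) x
  refine h3.congr_deriv ?_
  unfold hilbProfile
  field_simp
  ring

/-- `𝒰_f(0) = 0`. [folklore] -/
theorem primProfile_zero : primProfile 0 = 0 := by simp [primProfile]

/-- `f′(0) = 1` (so `−Ω_a′(0) = A/ℓ` for `Ω_a(ξ) = −A f(ξ/ℓ)`). [folklore] -/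
theorem dProfile_zero : dProfile 0 = 1 := by simp [dProfile]

/-- `(Hf)(0) = −1/2` (so `HΩ_a(0) = A/2`). [folklore] -/
theorem hilbProfile_zero : hilbProfile 0 = -1 / 2 := by norm_num [hilbProfile]

/-- MECHANISM: `f″ = 24·(Hf)·f` identically — Laplacian dissipation renormalises the quadratic term on this profile. [folklore] -/
theorem ddProfile_eq (x : ℝ) : ddProfile x = 24 * hilbProfile x * profile x := by
  have hne : (1 : ℝ) + x ^ 2 ≠ 0 := by positivity
  unfold ddProfile hilbProfile profile
  field_simp
  ring

/-- Residual of the row equation `c_ω Ω + c_l ξ Ω′ + a 𝒰 Ω′ − (HΩ) Ω − ε Ω″` for the dilated ansatz `Ω(ξ) = −A f(ξ/ℓ)`, written at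
`ξ = ℓ x` with the dilation rules `Ω′(ξ) = −(A/ℓ) f′(x)`, `Ω″(ξ) = −(A/ℓ²) f″(x)`, `HΩ(ξ) = −A (Hf)(x)` (H commutes with positive
dilations, folklore) and `𝒰(ξ) = −A ℓ 𝒰_f(x)`. [folklore] -/
noncomputable def rowResidual (cω cl a ε A ℓ x : ℝ) : ℝ :=
  cω * (-A * profile x) + cl * (ℓ * x) * (-(A / ℓ) * dProfile x)
    + a * (-A * ℓ * primProfile x) * (-(A / ℓ) * dProfile x)
    - (-A * hilbProfile x) * (-A * profile x) - ε * (-(A / ℓ ^ 2) * ddProfile x)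

/-- The quadratic `P(y)` (in `y = x²`) with `rowResidual = −(A x/(1+x²)⁴)·P(x²)` for `c_ω = 1`; `d` stands for `ε/ℓ²`. [folklore] -/
noncomputable def rowPoly (cl a A d y : ℝ) : ℝ :=
  (1 - 3 * cl) * y ^ 2 + (2 - 2 * cl - 3 * a * A / 2 + A / 2 - 12 * d) * y + (1 + cl + a * A / 2 - A / 2 + 12 * d)

/-- Factorisation of the residual (`c_ω = 1`, `ℓ ≠ 0`). [folklore] -/
theorem rowResidual_eq (cl a ε A ℓ x : ℝ) (hℓ : ℓ ≠ 0) :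
    rowResidual 1 cl a ε A ℓ x = -(A * x / (1 + x ^ 2) ^ 4) * rowPoly cl a A (ε / ℓ ^ 2) (x ^ 2) := by
  have hne : (1 : ℝ) + x ^ 2 ≠ 0 := by positivity
  unfold rowResidual rowPoly profile hilbProfile primProfile dProfile ddProfile
  field_simp
  ring

/-- THE EXACT ROW: for `0 < a`, `c_l = 1/3`, `A = 8/(3a)` and `ℓ ≠ 0` with `ℓ²(1 − 2a) = 9 ε a`, the dilated double-pole profile
solves the row equation identically in `x` (any `ε`; for `ε > 0` this needs `a < 1/2`). [folklore] -/
theorem rowResidual_third_eq_zero {a ε ℓ : ℝ} (ha : a ≠ 0) (hℓ : ℓ ≠ 0) (hwidth : ℓ ^ 2 * (1 - 2 * a) = 9 * ε * a)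
    (x : ℝ) : rowResidual 1 (1 / 3) a ε (8 / (3 * a)) ℓ x = 0 := by
  rw [rowResidual_eq _ _ _ _ _ _ hℓ]
  have hℓ2 : ℓ ^ 2 ≠ 0 := pow_ne_zero 2 hℓ
  have hfac : rowPoly (1 / 3) a (8 / (3 * a)) (ε / ℓ ^ 2) (x ^ 2)
      = (x ^ 2 - 1) * (4 / (3 * a) - 8 / 3 - 12 * (ε / ℓ ^ 2)) := by
    unfold rowPoly
    field_simp
    ring
  have hkey : 4 / (3 * a) - 8 / 3 - 12 * (ε / ℓ ^ 2) = (4 * (ℓ ^ 2 * (1 - 2 * a)) - 36 * ε * a) / (3 * a * ℓ ^ 2) := by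
    field_simp
    ring
  rw [hfac, hkey, hwidth]
  ring

/-- CONVERSE (no other row admits the ansatz): if the residual vanishes for all `x` with `A ≠ 0`, `ℓ ≠ 0`, then `c_l = 1/3`,
`a·A = 8/3` and `12 ε = (A/2 − 8/3)·ℓ²`. [folklore] -/
theorem eq_third_of_rowResidual_eq_zero {cl a ε A ℓ : ℝ} (hA : A ≠ 0) (hℓ : ℓ ≠ 0)
    (h : ∀ x : ℝ, rowResidual 1 cl a ε A ℓ x = 0) :
    cl = 1 / 3 ∧ a * A = 8 / 3 ∧ 12 * ε = (A / 2 - 8 / 3) * ℓ ^ 2 := by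
  have hP : ∀ x : ℝ, x ≠ 0 → rowPoly cl a A (ε / ℓ ^ 2) (x ^ 2) = 0 := by
    intro x hx
    have hx' := h x
    rw [rowResidual_eq _ _ _ _ _ _ hℓ] at hx'
    have hpre : -(A * x / (1 + x ^ 2) ^ 4) ≠ 0 := by
      have hne : (1 : ℝ) + x ^ 2 ≠ 0 := by positivity
      exact neg_ne_zero.mpr (div_ne_zero (mul_ne_zero hA hx) (pow_ne_zero 4 hne))
    exact (mul_eq_zero.mp hx').resolve_left hpre
  have h1 := hP 1 one_ne_zero
  have h2 := hP 2 two_ne_zero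
  have h3 := hP 3 (by norm_num)
  unfold rowPoly at h1 h2 h3
  norm_num at h1 h2 h3
  have hℓ2 : ℓ ^ 2 ≠ 0 := pow_ne_zero 2 hℓ
  -- the three values of the quadratic in `y = 1, 4, 9` determine its three coefficients (Vandermonde)
  have c2 : 1 - 3 * cl = 0 := by linarith
  have c1 : 2 - 2 * cl - 3 * a * A / 2 + A / 2 - 12 * (ε / ℓ ^ 2) = 0 := by linarith
  have c0 : 1 + cl + a * A / 2 - A / 2 + 12 * (ε / ℓ ^ 2) = 0 := by linarith
  have hcl : cl = 1 / 3 := by linarith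
  have haA : a * A = 8 / 3 := by linarith
  refine ⟨hcl, haA, ?_⟩
  have hd : 12 * (ε / ℓ ^ 2) = A / 2 - 8 / 3 := by linarith
  calc 12 * ε = 12 * (ε / ℓ ^ 2) * ℓ ^ 2 := by field_simp
    _ = (A / 2 - 8 / 3) * ℓ ^ 2 := by rw [hd]

/-- The width relation in the form used by the sheet: `9 ε a = (1 − 2a) ℓ²` follows from the converse's conclusions. [folklore] -/
theorem width_relation {a ε A ℓ : ℝ} (hA : a * A = 8 / 3) (hε : 12 * ε = (A / 2 - 8 / 3) * ℓ ^ 2) :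
    9 * ε * a = (1 - 2 * a) * ℓ ^ 2 := by
  have ha : a ≠ 0 := by
    rintro rfl
    norm_num at hA
  have hA' : A = 8 / (3 * a) := by
    field_simp
    linarith
  subst hA'
  have h1 : (8 / (3 * a) / 2 - 8 / 3 : ℝ) = 4 * (1 - 2 * a) / (3 * a) := by
    field_simp
    ring
  rw [h1] at hε
  have h2 : 9 * ε * a = 3 * a / 4 * (12 * ε) := by ring
  rw [h2, hε]
  field_simp

/-- END RELATION = the square-root delocalisation law in closed form: with `κ := −Ω_a′(0) = A/ℓ`, `A = 8/(3a)`,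
`ℓ²(1 − 2a) = 9 ε a`: `81 ε a³ κ² = 64 (1 − 2a)` (so `1/2 − a = (81/128) ε a³ κ²`, i.e. `δ ≈ (81/1024) ε κ²` near `a = 1/2`). [folklore] -/
theorem endpoint_relation {a ε ℓ : ℝ} (ha : a ≠ 0) (hℓ : ℓ ≠ 0) (hwidth : ℓ ^ 2 * (1 - 2 * a) = 9 * ε * a) :
    81 * ε * a ^ 3 * ((8 / (3 * a)) / ℓ) ^ 2 = 64 * (1 - 2 * a) := by
  have hℓ2 : ℓ ^ 2 ≠ 0 := pow_ne_zero 2 hℓ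
  have h1 : (1 - 2 * a) = 9 * ε * a / ℓ ^ 2 := by
    rw [eq_div_iff hℓ2]
    linarith [hwidth]
  rw [h1]
  field_simp
  ring

/-- INVISCID EDGE: at `ε = 0` the width relation forces `a = 1/2` (ℓ free) — the row's end is the inviscid point `α(1/2) = 1/3`,
where `A = 8/(3a) = 16/3` recovers the closed form of [cite: LushnikovSilantyevSiegel2021, Thm. 2]. -/
theorem inviscid_edge {a ℓ : ℝ} (hℓ : ℓ ≠ 0) (hwidth : ℓ ^ 2 * (1 - 2 * a) = 9 * 0 * a) :
    a = 1 / 2 ∧ (8 : ℝ) / (3 * (1 / 2)) = 16 / 3 := by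
  have hℓ2 : ℓ ^ 2 ≠ 0 := pow_ne_zero 2 hℓ
  have h0 : ℓ ^ 2 * (1 - 2 * a) = 0 := by simpa using hwidth
  have : 1 - 2 * a = 0 := (mul_eq_zero.mp h0).resolve_left hℓ2
  exact ⟨by linarith, by norm_num⟩

/-- `f(x)² ≤ 27/256` for all real `x` (`27(1+y)⁴ − 256 y = (3y − 1)²(3y² + 14y + 27)`, `y = x²`): the profile's sup is `3√3/16`. [folklore] -/
theorem profile_sq_le (x : ℝ) : profile x ^ 2 ≤ 27 / 256 := by
  unfold profile
  have hpos : 0 < (1 + x ^ 2) ^ 2 := by positivity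
  rw [div_pow, div_le_div_iff₀ (by positivity) (by norm_num)]
  have hy : 0 ≤ x ^ 2 := sq_nonneg x
  have key : 256 * x ^ 2 ≤ 27 * (1 + x ^ 2) ^ 4 := by
    nlinarith [sq_nonneg (3 * x ^ 2 - 1), mul_nonneg hy (sq_nonneg (3 * x ^ 2 - 1)),
      mul_nonneg (mul_nonneg hy hy) (sq_nonneg (3 * x ^ 2 - 1))]
  calc x ^ 2 * 256 = 256 * x ^ 2 := by ring
    _ ≤ 27 * (1 + x ^ 2) ^ 4 := key
    _ = 27 * ((1 + x ^ 2) ^ 2) ^ 2 := by ring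

/-- Equality case: `f(1/√3) = 3√3/16`. [folklore] -/
theorem profile_inv_sqrt_three : profile (Real.sqrt 3 / 3) = 3 * Real.sqrt 3 / 16 := by
  have h3 : Real.sqrt 3 ^ 2 = 3 := Real.sq_sqrt (by norm_num)
  unfold profile
  rw [div_pow, h3]
  norm_num
  ring

/-- AMPLITUDE of the exact row: `max |Ω_a| = A · 3√3/16 = √3/(2a)` for `A = 8/(3a)` (e.g. `5/√3` at `a = 3/10`, `→ √3` as `a → 1/2`,
the amplitude of the inviscid `α = 1/3` profile). [folklore] -/
theorem amplitude_third {a : ℝ} (ha : a ≠ 0) : 8 / (3 * a) * (3 * Real.sqrt 3 / 16) = Real.sqrt 3 / (2 * a) := by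
  field_simp
  ring

/-- ORIGIN VALUE of the exact row: `HΩ_a(0) = −A·(Hf)(0) = A/2 = 4/(3a)` (e.g. `40/9` at `a = 3/10`; `8/3` at `a = 1/2`). [folklore] -/
theorem origin_value_third {a : ℝ} (ha : a ≠ 0) : -(8 / (3 * a)) * hilbProfile 0 = 4 / (3 * a) := by
  rw [hilbProfile_zero]
  field_simp
  ring

end SheetRowThirdExactFamily
end Summit.NavierStokesRegularity.OSWSelfSimilar
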